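import Summits.HubbardSuperconductivity.HubbardSuperconductivity.Theorems.LevyLogBootstrapDressHalfFilledDictionaryAssembly
import Summits.HubbardSuperconductivity.HubbardSuperconductivity.Theorems.LevyLogBootstrapDressHalfFilledDictionaryLocality
import Summits.HubbardSuperconductivity.HubbardSuperconductivity.Theorems.LevyLogBootstrapDressHalfFilledKernelXXZOfUnique
import HarnessLib

/-!
# Route `LevyLogBootstrap` / `AnisotropyChord`, crux `DressHalfFilled` (stmt-HubbardSuperconductivity-8148), stub 2
# `stub_plaquetteDictionary`: THE DICTIONARY FROM THE PLAQUETTE DATA — every `U`, no window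

Support file (`--supports stmt-HubbardSuperconductivity-8148`). The registered stub of the skeleton
`Cruxes/DressHalfFilled/Lines/birth.lean` is `stub_plaquetteDictionary : ∀ U : ℝ, 0 < U → PlaquetteData U →
PlaquetteDictionary U`. This file proves its content with both abbreviations written out verbatim (the skeleton's `def`s
are not importable from `Theorems/`):

* `dictionaryMap_kernel_clause_of_unique` — clause (d) for `Φ = TorusPlaquette.dictionaryMap M U` (`M ≥ 3`) from
  `J(U) ≠ 0` and the (W4) uniqueness clauses ALONE: `…DictionaryLocality.dictionaryMap_kernel_pullback_of` fed with the
  window-free kernel table (`…KernelTableOfUnique.kernel_bonds_eq_plaquetteKernel_of_unique`) and bond sum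
  (`…KernelXXZOfUnique.plaquetteKernel_bondSum_eq_xxz_of_unique`);
* **`plaquetteDictionary_of_plaquetteData`** — `⟨PlaquetteData U⟩ → ⟨PlaquetteDictionary U⟩` for EVERY real `U`
  (uses (W1)'s `0 < J` and (W3)–(W5); via `…DictionaryAssembly.dressHalfFilled_dictionaryOfKernel`).

The by-name close of the stub (same statement against re-declared abbreviations) is a separate, reviewed file.

References: W.-F. Tsai, S. A. Kivelson, PRB 73 (2006) 214510, App. A (A1) [TsaiKivelson2006]; H. Yao, W.-F. Tsai,
S. A. Kivelson, PRB 76 (2007) 161104(R), eq. (2) [YaoTsaiKivelson2007]; T. Kato (1966) II-§2.2 (2.20). No definition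
and no named fact is introduced.
-/

set_option linter.dupNamespace false

noncomputable section

namespace Summit.HubbardSuperconductivity.HubbardSuperconductivity.Theorems.LevyLogBootstrap

open Matrix Finset Literature.MathematicalPhysics.QuantumLattice Literature.Probability.LatticeModels
open Literature.MathematicalPhysics.QuantumLattice.TorusPlaquette
open scoped ComplexOrder

variable {M : ℕ} [NeZero M]

/-- **Clause (d) along `dictionaryMap M U` from the plaquette data alone** (`J(U) ≠ 0`, (W4) uniqueness of the `(4,0)`
and `(2,0)` plaquette ground states, `M ≥ 3`; no `U`-window): verbatim the hypothesis `hd` of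
`…DictionaryAssembly.dictionaryOfKernel`, with `k(N_b) = 2M²(Re K(0,0) − V/4) + 4(μ + V/2) N_b`.
[cite: YaoTsaiKivelson2007, eq. (2)] -/
theorem dictionaryMap_kernel_clause_of_unique {U : ℝ} (hJ : (plaquettePairCouplings U).J ≠ 0)
    (h4 : ∀ φ₁ φ₂ : Fock (Orb PlaquetteSite), IsGroundStateInSector (plaquetteHamiltonian U) 4 0 φ₁ →
      IsGroundStateInSector (plaquetteHamiltonian U) 4 0 φ₂ → ∃ a : ℂ, φ₂ = a • φ₁)
    (h2 : ∀ φ₁ φ₂ : Fock (Orb PlaquetteSite), IsGroundStateInSector (plaquetteHamiltonian U) 2 0 φ₁ →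
      IsGroundStateInSector (plaquetteHamiltonian U) 2 0 φ₂ → ∃ a : ℂ, φ₂ = a • φ₁)
    (hM : 3 ≤ M) :
    ∃ k : ℕ → ℝ, ∀ Nb : ℕ, Nb ≤ M ^ 2 → ∀ φ φ' : TensorIndex (TorusSite 2 M) 2 → ℂ,
      φ ∈ spinZSector (Λ := TorusSite 2 M) 1 ((Nb : ℝ) - (M : ℝ) ^ 2 / 2) →
      φ' ∈ spinZSector (Λ := TorusSite 2 M) 1 ((Nb : ℝ) - (M : ℝ) ^ 2 / 2) →
      star (TorusPlaquette.dictionaryMap M U *ᵥ φ') ⬝ᵥ ((hamiltonian ((fermionTorusGraph 2 (2 * M)) ⊓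
        SimpleGraph.comap (fun x : FermionTorus 2 (2 * M) => fun i : Fin 2 => ((ofLex x) i : ℕ) / 2) ⊤) 1 0 *
        reducedResolvent (hamiltonian ((fermionTorusGraph 2 (2 * M)) \
          SimpleGraph.comap (fun x : FermionTorus 2 (2 * M) => fun i : Fin 2 => ((ofLex x) i : ℕ) / 2) ⊤) 1 U)
          (((M : ℝ) ^ 2 - (Nb : ℝ)) * (plaquettePairCouplings U).E 0 + (Nb : ℝ) * (plaquettePairCouplings U).E 2) *
        hamiltonian ((fermionTorusGraph 2 (2 * M)) ⊓
          SimpleGraph.comap (fun x : FermionTorus 2 (2 * M) => fun i : Fin 2 => ((ofLex x) i : ℕ) / 2) ⊤) 1 0) *ᵥ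
        (TorusPlaquette.dictionaryMap M U *ᵥ φ)) =
      -(star φ' ⬝ᵥ ((((2 * (plaquettePairCouplings U).J : ℝ) : ℂ) •
        xxzHamiltonian 1 (torusGraph 2 M) (-1) (plaquettePairCouplings U).ΔEff + ((k Nb : ℝ) : ℂ) • 1) *ᵥ φ)) :=
  ⟨fun Nb => 2 * (M : ℝ) ^ 2 * ((plaquetteKernel U (0, 0) (0, 0)).re - (plaquettePairCouplings U).V / 4) +
      4 * ((plaquettePairCouplings U).μ + (plaquettePairCouplings U).V / 2) * (Nb : ℝ),
    fun _ hNb _ _ hφ hφ' => dictionaryMap_kernel_pullback_of hM U (kernel_bonds_eq_plaquetteKernel_of_unique h4 h2)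
      (fun n => 2 * (M : ℝ) ^ 2 * ((plaquetteKernel U (0, 0) (0, 0)).re - (plaquettePairCouplings U).V / 4) +
        4 * ((plaquettePairCouplings U).μ + (plaquettePairCouplings U).V / 2) * (n : ℝ))
      (fun σ' σ => plaquetteKernel_bondSum_eq_xxz_of_unique h4 h2 hJ M hM σ' σ) hNb hφ hφ'⟩

set_option linter.style.longLine false in
/-- **THE PLAQUETTE-BOSON DICTIONARY FROM THE PLAQUETTE DATA, every real `U`**: the plaquette data `PlaquetteData U`
(verbatim body of the skeleton's abbreviation; only (W1)'s `0 < J` and (W3)–(W5) are used) imply the second-order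
dictionary `PlaquetteDictionary U` (verbatim body) with `Φ = TorusPlaquette.dictionaryMap M U`, `L = 2M`. This is the
content of the registered stub `stub_plaquetteDictionary` (whose hypothesis `0 < U` is not needed).
[cite: TsaiKivelson2006, App. A (A1)] -/
theorem plaquetteDictionary_of_plaquetteData (U : ℝ)
    (hPD : (0 < (plaquettePairCouplings U).J ∧ 0 ≤ (plaquettePairCouplings U).V ∧
      (plaquettePairCouplings U).V < 2 * (plaquettePairCouplings U).J) ∧
  0 < (plaquettePairCouplings U).c ∧
  (0 < (plaquettePairCouplings U).pairBinding ∧ 0 < (plaquettePairCouplings U).pairExclusion ∧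
    ∀ n : ℕ, n ≤ 8 → n ≠ 2 → n ≠ 4 →
      (4 - (n : ℝ)) * groundEnergyAt plaquetteGraph 1 U 2 + ((n : ℝ) - 2) * groundEnergyAt plaquetteGraph 1 U 4 <
        2 * groundEnergyAt plaquetteGraph 1 U n) ∧
  (∀ φ₁ φ₂ : Fock (Orb PlaquetteSite), IsGroundStateInSector (plaquetteHamiltonian U) 4 0 φ₁ →
    IsGroundStateInSector (plaquetteHamiltonian U) 4 0 φ₂ → ∃ a : ℂ, φ₂ = a • φ₁) ∧
  (∀ φ₁ φ₂ : Fock (Orb PlaquetteSite), IsGroundStateInSector (plaquetteHamiltonian U) 2 0 φ₁ →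
    IsGroundStateInSector (plaquetteHamiltonian U) 2 0 φ₂ → ∃ a : ℂ, φ₂ = a • φ₁) ∧
  (∀ m : ℝ, m = 1 ∨ m = -1 ∨ m = 2 ∨ m = -2 →
    (plaquetteHamiltonian U).minEnergyOn (szSector 4 0) < (plaquetteHamiltonian U).minEnergyOn (szSector 4 m)) ∧
  (∀ m : ℝ, m = 1 ∨ m = -1 →
    (plaquetteHamiltonian U).minEnergyOn (szSector 2 0) < (plaquetteHamiltonian U).minEnergyOn (szSector 2 m))) :
    ∀ (L M : ℕ) [NeZero L] [NeZero M], L = 2 * M → 8 ≤ L → 4 ∣ L →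
    let C := plaquettePairCouplings U;
    let Hin := hamiltonian ((fermionTorusGraph 2 L) \ SimpleGraph.comap
      (fun x : FermionTorus 2 L => fun i : Fin 2 => ((ofLex x) i : ℕ) / 2) ⊤) 1 U;
    let T := hamiltonian ((fermionTorusGraph 2 L) ⊓ SimpleGraph.comap
      (fun x : FermionTorus 2 L => fun i : Fin 2 => ((ofLex x) i : ℕ) / 2) ⊤) 1 0;
    let E₀ : ℕ → ℝ := fun Nb => ((M : ℝ) ^ 2 - (Nb : ℝ)) * C.E 0 + (Nb : ℝ) * C.E 2;
    ∃ Φ : Matrix (Finset (Orb (FermionTorus 2 L))) (TensorIndex (TorusSite 2 M) 2) ℂ,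
      Φᴴ * Φ = 1 ∧
      (∀ Nb : ℕ, Nb ≤ M ^ 2 → ∀ φ : TensorIndex (TorusSite 2 M) 2 → ℂ,
        φ ∈ spinZSector (Λ := TorusSite 2 M) 1 ((Nb : ℝ) - (M : ℝ) ^ 2 / 2) →
        Φ *ᵥ φ ∈ szSector (Λ := FermionTorus 2 L) (L ^ 2 - 2 * Nb) 0 ∧
        Hin *ᵥ (Φ *ᵥ φ) = ((E₀ Nb : ℝ) : ℂ) • (Φ *ᵥ φ)) ∧
      (∀ Nb : ℕ, Nb ≤ M ^ 2 →
        Hin.minEnergyOn (szSector (Λ := FermionTorus 2 L) (L ^ 2 - 2 * Nb) 0) = E₀ Nb ∧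
        ∀ ψ : Fock (Orb (FermionTorus 2 L)), ψ ∈ szSector (Λ := FermionTorus 2 L) (L ^ 2 - 2 * Nb) 0 →
          Hin *ᵥ ψ = ((E₀ Nb : ℝ) : ℂ) • ψ →
          ∃ φ : TensorIndex (TorusSite 2 M) 2 → ℂ,
            φ ∈ spinZSector (Λ := TorusSite 2 M) 1 ((Nb : ℝ) - (M : ℝ) ^ 2 / 2) ∧ ψ = Φ *ᵥ φ) ∧
      (∃ k : ℕ → ℝ, ∀ Nb : ℕ, Nb ≤ M ^ 2 → ∀ φ φ' : TensorIndex (TorusSite 2 M) 2 → ℂ,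
        φ ∈ spinZSector (Λ := TorusSite 2 M) 1 ((Nb : ℝ) - (M : ℝ) ^ 2 / 2) →
        φ' ∈ spinZSector (Λ := TorusSite 2 M) 1 ((Nb : ℝ) - (M : ℝ) ^ 2 / 2) →
        star (Φ *ᵥ φ') ⬝ᵥ ((T * reducedResolvent Hin (E₀ Nb) * T) *ᵥ (Φ *ᵥ φ)) =
          -(star φ' ⬝ᵥ ((((2 * C.J : ℝ) : ℂ) • xxzHamiltonian 1 (torusGraph 2 M) (-1) C.ΔEff +
            ((k Nb : ℝ) : ℂ) • 1) *ᵥ φ))) ∧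
      Φᴴ * pairField dWaveFormFactor L * Φ = ((C.c : ℝ) : ℂ) • ∑ R : TorusSite 2 M, onSite R (spinRaise 1) := by
  obtain ⟨⟨hJ, -, -⟩, -, ⟨-, -, hW3⟩, hW4a, hW4b, hW5a, hW5b⟩ := hPD
  exact dressHalfFilled_dictionaryOfKernel U hW3 hW4a hW4b hW5a hW5b
    (fun M _ hM4 _ => dictionaryMap_kernel_clause_of_unique hJ.ne' hW4a hW4b (by omega))

end Summit.HubbardSuperconductivity.HubbardSuperconductivity.Theorems.LevyLogBootstrap

end
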